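import Literature.RepresentationTheory.Kovacevic2021.SU21GaugeExistence
import Literature.RepresentationTheory.Kovacevic2021.SU21CohomologicalClassification
import HarnessLib

/-!
# Recognising the six cohomological modules of `SU(2,1)` by their `K`-types

Continuation of `…Kovacevic2021.SU21GaugeExistence` (two strongly connected data with the same `K`-types, a
common vertex, a square-complete `K`-type set and the same gauge-invariant products have isomorphic
`𝔤𝔩(3,ℂ)`-modules: `nonempty_equiv_of_products_eq`) and `…SU21VertexRigidity` (unique continuation from the
vertex: `mem_iff_and_products_eq_of_vertex`) [Kovacevic2021, §3 Thm 2, Remark 3].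

**Recognition theorem** (`nonempty_equiv_of_S_eq_of_vertex` and its six instances
`nonempty_equiv_trivialMod_of_S_eq`, `…holDS…`, `…antiholDS…`, `…ladderPlus…`, `…ladderMinus…`, `…midDS…`):
a STRONGLY CONNECTED datum `𝒟` (any `K`-type reached from any other along live arrows) whose `K`-type set is
that of one of the six cohomological modules `T ∈ {U(0), U(0,±6), Z(±3), W(3,0)}` of
`SU21ModulesFromKTypes` — and, when `T` has a `K`-type of dimension `n = 1`, whose Casimir scalar vanishes
there — is isomorphic to `T` as a `𝔤𝔩(3,ℂ)`-module.  (The `K`-types alone do not suffice on the level `n = 1`: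
the ray data `rayNE e 1 _ _` exist for every `e`; for `n ≥ 2` the relations (b20), (b25) at the vertex are a
non-degenerate Cramer system and no Casimir hypothesis is needed.)  This is the form of Kovačević's "it is
possible to reconstruct an irreducible `(𝔤,K)` module" [§3 Thm 2, last sentence] used by
`SU21PrincipalSeriesCompositionFactors` to identify subquotients of the principal series with the six modules
[BorelWallach2000, VI 4.10 (10)].

Also here (§1): for Lie submodules `N, N'` of `𝒟.V`, the `K`-types met by `N ⊔ N'` are those met by `N` or by
`N'` (`vec_one_mem_sup_iff`; a Lie submodule is spanned by the basis vectors it contains,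
`SU21SubmoduleLattice.single_mem_of_mem_support`).

## References

* D. Kovačević, *Unitary `(𝔤,K)` modules of `SU(2,1)`*, Acta Math. Spalatensia 1 (2021) 105–125
  (arXiv:1810.01752): §3 Thm 2, Remark 3; §4. [Kovacevic2021]
* A. Borel, N. Wallach (2000), VI 4.8, 4.10 (10), Thm 4.11 p. 131–132. [BorelWallach2000]
-/

noncomputable section

namespace Literature.RepresentationTheory.Kovacevic2021

-- Mathlib idiom (Mathlib/Algebra/Lie/OfAssociative.lean): commutator brackets on associative algebras; needed for
-- the `𝔤𝔩(3,ℂ)`-module structure on `𝒟.V`, as in every file of this directory.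
attribute [local instance 100] LieRing.ofAssociativeRing

namespace SU21Datum

variable {𝒟 : SU21Datum}

/-! ## §1 The `K`-types of a join of two Lie submodules -/

/-- **The `K`-types met by `N ⊔ N'` are those met by `N` or by `N'`** (if `u^1_{n,m} = y + z` with `y ∈ N`,
`z ∈ N'`, the label of `u^1_{n,m}` is in the support of `y` or of `z`, and a Lie submodule contains every basis
vector in the support of its elements). [cite: Kovacevic2021, §3 Thm 2, Remark 2] -/
theorem vec_one_mem_sup_iff (N N' : LieSubmodule ℂ (Matrix (Fin 3) (Fin 3) ℂ) 𝒟.V) {n m : ℤ} (hS : (n, m) ∈ 𝒟.S) :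
    𝒟.vec n m 1 ∈ N ⊔ N' ↔ 𝒟.vec n m 1 ∈ N ∨ 𝒟.vec n m 1 ∈ N' := by
  refine ⟨fun h => ?_, fun h => h.elim (fun h => LieSubmodule.mem_sup_left h) fun h => LieSubmodule.mem_sup_right h⟩
  obtain ⟨y, hy, z, hz, hyz⟩ := (LieSubmodule.mem_sup _ _ _).1 h
  have h1 : (n, m) ∈ 𝒟.S ∧ (1 : ℤ) ≤ 1 ∧ 1 ≤ n := ⟨hS, le_rfl, 𝒟.one_le_of_mem hS⟩
  set t : 𝒟.Idx := ⟨(n, m, 1), h1⟩ with ht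
  have hv : 𝒟.vec n m 1 = Finsupp.single t 1 := vec_of_pos n m 1 h1
  have hsum : y t + z t = 1 := by
    have := DFunLike.congr_fun hyz t
    rwa [Finsupp.add_apply, hv, Finsupp.single_eq_same] at this
  by_cases hyt : y t = 0
  · right
    have hzt : t ∈ z.support := Finsupp.mem_support_iff.2 (by rw [hyt, zero_add] at hsum; rw [hsum]; exact one_ne_zero)
    rw [hv]; exact single_mem_of_mem_support N' hz hzt
  · left
    rw [hv]; exact single_mem_of_mem_support N hy (Finsupp.mem_support_iff.2 hyt)

/-! ## §2 Recognition from the `K`-types, the vertex and strong connectivity -/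

/-- **Recognition theorem, general form.** Let `𝒟` and `T` be strongly connected data with the same `K`-types,
let `x₀` be a local minimum of `T.S` (no `K`-type at `(x₀.1-1, x₀.2∓3)`) with `T.S` square-complete, and suppose
the Casimir scalars of both vanish on the `K`-types of dimension `1`.  Then `𝒟.V ≅ T.V` as `𝔤𝔩(3,ℂ)`-modules
(unique continuation of the invariant products from the vertex, then the gauge).
[cite: Kovacevic2021, §3 Thm 2 (last sentence), Remark 3] -/
theorem nonempty_equiv_of_S_eq_of_vertex {T : SU21Datum} {x₀ : ℤ × ℤ} (hS : 𝒟.S = T.S)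
    (hconn : ∀ x ∈ 𝒟.S, ∀ y ∈ 𝒟.S, 𝒟.Reach x y) (hconnT : ∀ x ∈ T.S, ∀ y ∈ T.S, T.Reach x y)
    (h₀ : x₀ ∈ T.S) (h₀D : (x₀.1 - 1, x₀.2 - 3) ∉ T.S) (h₀C : (x₀.1 - 1, x₀.2 + 3) ∉ T.S)
    (hsq : ∀ n m : ℤ, (n, m - 3) ∈ T.S → (n, m + 3) ∈ T.S → (n + 1, m) ∈ T.S → (n - 1, m) ∈ T.S)
    (hcas : ∀ m : ℤ, ((1 : ℤ), m) ∈ 𝒟.S → 𝒟.casimirScalar 1 m = 0)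
    (hcasT : ∀ m : ℤ, ((1 : ℤ), m) ∈ T.S → T.casimirScalar 1 m = 0) :
    Nonempty (𝒟.V ≃ₗ⁅ℂ, Matrix (Fin 3) (Fin 3) ℂ⁆ T.V) := by
  have h₁ : x₀ ∈ 𝒟.S := by rw [hS]; exact h₀
  have h₁D : (x₀.1 - 1, x₀.2 - 3) ∉ 𝒟.S := by rw [hS]; exact h₀D
  have h₁C : (x₀.1 - 1, x₀.2 + 3) ∉ 𝒟.S := by rw [hS]; exact h₀C
  have key := fun n m => mem_iff_and_products_eq_of_vertex h₁ h₀
    (fun n m hy hne => exists_lower_of_ne hconn h₁ h₁D h₁C hy hne)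
    (fun n m hy hne => exists_lower_of_ne hconnT h₀ h₀D h₀C hy hne) hcas hcasT n m
  exact nonempty_equiv_of_products_eq hS hconn hconnT h₁ h₁D h₁C
    (fun n m h1 h2 h3 => by rw [hS] at *; exact hsq n m h1 h2 h3)
    (fun n m => (key n m).2.1) (fun n m => (key n m).2.2)

/-- the `K`-types of `U(0)`: the single point `V_{1,0}` [cite: Kovacevic2021, §4 (`U(0)`)] -/
theorem mem_trivialMod_iff (n m : ℤ) : (n, m) ∈ trivialMod.S ↔ n = 1 ∧ m = 0 := by
  change (n, m) ∈ ({((1 : ℤ), (0 : ℤ))} : Set (ℤ × ℤ)) ↔ _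
  rw [Set.mem_singleton_iff, Prod.mk.injEq]

/-- the `K`-types of `W(3,0)` in integer cone coordinates: `V_{1+p+q, 3p−3q}`, `p, q ≥ 1`
[cite: Kovacevic2021, §4 (`W(r,s)`)] [cite: BorelWallach2000, VI 4.8] -/
theorem mem_midDS_iff_int (n m : ℤ) :
    (n, m) ∈ midDS.S ↔ ∃ p q : ℤ, 1 ≤ p ∧ 1 ≤ q ∧ n = 1 + p + q ∧ m = 3 * p - 3 * q := by
  rw [mem_midDS]
  constructor
  · rintro ⟨p, q, hn, hm⟩
    exact ⟨p + 1, q + 1, by omega, by omega, by omega, by omega⟩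
  · rintro ⟨p, q, hp, hq, hn, hm⟩
    exact ⟨(p - 1).toNat, (q - 1).toNat, by omega, by omega⟩

/-- **`U(0)` is recognised by its `K`-type**: a datum with the single `K`-type `V_{1,0}` and Casimir scalar `0`
there is the trivial module. [cite: Kovacevic2021, §4 (`U(0) = V_{10}`)] [cite: BorelWallach2000, VI 4.8 (`J_{0,0}`)] -/
theorem nonempty_equiv_trivialMod_of_S_eq (hS : 𝒟.S = trivialMod.S) (hconn : ∀ x ∈ 𝒟.S, ∀ y ∈ 𝒟.S, 𝒟.Reach x y)
    (hcas : ∀ m : ℤ, ((1 : ℤ), m) ∈ 𝒟.S → 𝒟.casimirScalar 1 m = 0) :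
    Nonempty (𝒟.V ≃ₗ⁅ℂ, Matrix (Fin 3) (Fin 3) ℂ⁆ trivialMod.V) :=
  haveI := trivialMod_isIrreducible
  nonempty_equiv_of_S_eq_of_vertex (x₀ := (1, 0)) hS hconn forall_reach_of_isIrreducible
    ((mem_trivialMod_iff 1 0).2 ⟨rfl, rfl⟩) (by rw [mem_trivialMod_iff]; omega) (by rw [mem_trivialMod_iff]; omega)
    (fun n m h1 h2 _ => by rw [mem_trivialMod_iff] at *; omega) hcas
    (fun m h => casimirScalar_eq_zero_of_casimir_eq_zero casimir_trivialMod h)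

/-- **`D₂ = U(0,6)` is recognised by its `K`-types** (the ray `V_{n,3n+3}`, `n ≥ 1`) and the vanishing of the
Casimir scalar at `V_{1,6}`. [cite: Kovacevic2021, §4 (`U(0,6)`)] [cite: BorelWallach2000, VI 4.8 (`D_2`)] -/
theorem nonempty_equiv_holDS_of_S_eq (hS : 𝒟.S = holDS.S) (hconn : ∀ x ∈ 𝒟.S, ∀ y ∈ 𝒟.S, 𝒟.Reach x y)
    (hcas : ∀ m : ℤ, ((1 : ℤ), m) ∈ 𝒟.S → 𝒟.casimirScalar 1 m = 0) :
    Nonempty (𝒟.V ≃ₗ⁅ℂ, Matrix (Fin 3) (Fin 3) ℂ⁆ holDS.V) :=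
  haveI := holDS_isIrreducible
  nonempty_equiv_of_S_eq_of_vertex (x₀ := (1, 6)) hS hconn forall_reach_of_isIrreducible
    ((mem_holDS 1 6).2 ⟨le_rfl, by norm_num⟩) (by rw [mem_holDS]; omega) (by rw [mem_holDS]; omega)
    (fun n m h1 h2 _ => by rw [mem_holDS] at *; omega) hcas
    (fun m h => casimirScalar_eq_zero_of_casimir_eq_zero casimir_holDS h)

/-- **`D₀ = U(0,−6)` is recognised by its `K`-types** (the ray `V_{n,−3n−3}`, `n ≥ 1`) and the vanishing of the
Casimir scalar at `V_{1,−6}`. [cite: Kovacevic2021, §4 (`U(0,−6)`)] [cite: BorelWallach2000, VI 4.8 (`D_0`)] -/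
theorem nonempty_equiv_antiholDS_of_S_eq (hS : 𝒟.S = antiholDS.S) (hconn : ∀ x ∈ 𝒟.S, ∀ y ∈ 𝒟.S, 𝒟.Reach x y)
    (hcas : ∀ m : ℤ, ((1 : ℤ), m) ∈ 𝒟.S → 𝒟.casimirScalar 1 m = 0) :
    Nonempty (𝒟.V ≃ₗ⁅ℂ, Matrix (Fin 3) (Fin 3) ℂ⁆ antiholDS.V) :=
  haveI := antiholDS_isIrreducible
  nonempty_equiv_of_S_eq_of_vertex (x₀ := (1, -6)) hS hconn forall_reach_of_isIrreducible
    ((mem_antiholDS 1 (-6)).2 ⟨le_rfl, by norm_num⟩) (by rw [mem_antiholDS]; omega) (by rw [mem_antiholDS]; omega)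
    (fun n m h1 h2 _ => by rw [mem_antiholDS] at *; omega) hcas
    (fun m h => casimirScalar_eq_zero_of_casimir_eq_zero casimir_antiholDS h)

/-- **`J_{1,0} = Z(3)` is recognised by its `K`-types alone** (the ray `V_{n,3n−3}`, `n ≥ 2`; no `K`-type of
dimension `1`). [cite: Kovacevic2021, §4 (`Z(3)`)] [cite: BorelWallach2000, VI 4.8, Thm 4.11 (9) (`J_{1,0}`)] -/
theorem nonempty_equiv_ladderPlus_of_S_eq (hS : 𝒟.S = ladderPlus.S) (hconn : ∀ x ∈ 𝒟.S, ∀ y ∈ 𝒟.S, 𝒟.Reach x y) :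
    Nonempty (𝒟.V ≃ₗ⁅ℂ, Matrix (Fin 3) (Fin 3) ℂ⁆ ladderPlus.V) :=
  haveI := ladderPlus_isIrreducible
  nonempty_equiv_of_S_eq_of_vertex (x₀ := (2, 3)) hS hconn forall_reach_of_isIrreducible
    ((mem_ladderPlus 2 3).2 ⟨le_rfl, by norm_num⟩) (by rw [mem_ladderPlus]; omega) (by rw [mem_ladderPlus]; omega)
    (fun n m h1 h2 _ => by rw [mem_ladderPlus] at *; omega)
    (fun m h => by rw [hS, mem_ladderPlus] at h; omega) (fun m h => by rw [mem_ladderPlus] at h; omega)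

/-- **`J_{0,1} = Z(−3)` is recognised by its `K`-types alone** (the ray `V_{n,−3n+3}`, `n ≥ 2`).
[cite: Kovacevic2021, §4 (`Z(−3)`)] [cite: BorelWallach2000, VI 4.8, Thm 4.11 (9) (`J_{0,1}`)] -/
theorem nonempty_equiv_ladderMinus_of_S_eq (hS : 𝒟.S = ladderMinus.S) (hconn : ∀ x ∈ 𝒟.S, ∀ y ∈ 𝒟.S, 𝒟.Reach x y) :
    Nonempty (𝒟.V ≃ₗ⁅ℂ, Matrix (Fin 3) (Fin 3) ℂ⁆ ladderMinus.V) :=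
  haveI := ladderMinus_isIrreducible
  nonempty_equiv_of_S_eq_of_vertex (x₀ := (2, -3)) hS hconn forall_reach_of_isIrreducible
    ((mem_ladderMinus 2 (-3)).2 ⟨le_rfl, by norm_num⟩) (by rw [mem_ladderMinus]; omega) (by rw [mem_ladderMinus]; omega)
    (fun n m h1 h2 _ => by rw [mem_ladderMinus] at *; omega)
    (fun m h => by rw [hS, mem_ladderMinus] at h; omega) (fun m h => by rw [mem_ladderMinus] at h; omega)

/-- **`D₁ = W(3,0)` is recognised by its `K`-types alone** (the quadrant `V_{1+p+q,3p−3q}`, `p, q ≥ 1`, vertex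
`V_{3,0} = F_{1,1}`). [cite: Kovacevic2021, §4 (`W(3,0)`)] [cite: BorelWallach2000, VI 4.8, 4.10 (3) (`D_1`)] -/
theorem nonempty_equiv_midDS_of_S_eq (hS : 𝒟.S = midDS.S) (hconn : ∀ x ∈ 𝒟.S, ∀ y ∈ 𝒟.S, 𝒟.Reach x y) :
    Nonempty (𝒟.V ≃ₗ⁅ℂ, Matrix (Fin 3) (Fin 3) ℂ⁆ midDS.V) := by
  haveI := midDS_isIrreducible
  refine nonempty_equiv_of_S_eq_of_vertex (x₀ := (3, 0)) hS hconn forall_reach_of_isIrreducible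
    ((mem_midDS_iff_int 3 0).2 ⟨1, 1, le_rfl, le_rfl, by norm_num, by norm_num⟩) ?_ ?_ ?_ ?_ ?_
  · rw [mem_midDS_iff_int]; rintro ⟨p, q, hp, hq, hn, hm⟩; omega
  · rw [mem_midDS_iff_int]; rintro ⟨p, q, hp, hq, hn, hm⟩; omega
  · intro n m h1 h2 _
    rw [mem_midDS_iff_int] at *
    obtain ⟨p₁, q₁, hp₁, hq₁, hn₁, hm₁⟩ := h1
    obtain ⟨p₂, q₂, hp₂, hq₂, hn₂, hm₂⟩ := h2
    exact ⟨p₁, q₂, hp₁, hq₂, by omega, by omega⟩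
  · intro m h; rw [hS, mem_midDS_iff_int] at h; obtain ⟨p, q, hp, hq, hn, -⟩ := h; omega
  · intro m h; rw [mem_midDS_iff_int] at h; obtain ⟨p, q, hp, hq, hn, -⟩ := h; omega

end SU21Datum

end Literature.RepresentationTheory.Kovacevic2021
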